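import Summits.CriticalPhenomena.PercolationContinuityZ3.Theorems.Transplant.FKConnectivityAllQAntipodalTwoSumHalf
import HarnessLib

/-!
# Connectivity correlation inequalities for `φ_{w,q}`, every `q > 0` — file 75b: **ACROSS A 2-SEPARATION THE LEVELWISE ANTIPODAL INEQUALITY
# REDUCES TO ONE 'DOUBLE-U' CROSS FORM** (the odd / even decomposition for a parallel gluing)

Support file (`--supports stmt-CriticalPhenomena-4575`), FK sub-lane `prim-bschramm-fk-2` (gen 33, landed by gen 34); builds on p205010 (kernel
theorem, internal audit signed; external expert review pending).  No definitions, no named facts, no sorries; standard axioms.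

File 75a proved that the levelwise antipodal inequality (`C_∞⁺` on a cell) is closed under ONE-sums for arbitrary test functions.  Here the same
odd / even decomposition is run across a TWO-terminal gluing `E₁ ∥_{s,t} E₂` (cells `(M_i, C_i)`, `st ∉ M₁ ∪ M₂`), where the level is no longer
additive: `apExpC M C γ + 2|V| = ℓ₁(γ₁) + ℓ₂(γ₂) + 1{s↔t on both γ-sides} + 1{s↔t on both complement sides}` (`FK.apExpC_parallel`).  Writing
`f̂(·,γ₂) = P + E`, `ĝ(·,γ₂) = Q + D` (odd / even under `γ₁ ↦ M₁∖γ₁`):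
* the `PQ` terms, symmetrised over `γ₂ ↦ M₂∖γ₂`, are — according to the type of `γ₂` — instances of the levelwise inequality on the THREE cells
  `(M₁, C₁)`, `(M₁, C₁ ∪ {st})`, `(M₁ ∪ {st}, C₁)` with averaged test functions (`FK.twoSum_half₁_nonpos`, file 75b-ii);
* the `ED` terms, symmetrised over `γ₁ ↦ M₁∖γ₁`, are instances on the three cells `(M₂, C₂)`, `(M₂, C₂ ∪ {st})`, `(M₂ ∪ {st}, C₂)`
  (`FK.twoSum_half₂_nonpos`);
* the cross terms `PD + EQ` do NOT cancel: they sum to `−½·𝕌` (`FK.twoSum_cross_le`, file 75b-i), where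
  **`𝕌 = Σ_{γ₁,γ₂ : ℓ₁(γ₁)+ℓ₂(γ₂) = J + 2|V|} u₁(γ₁) u₂(γ₂) f̂(γ₁,γ₂) ĝ(γ₁,γ₂)`**, `u_i(γ_i) = 1{s↔t in γ_i∪C_i} − 1{s↔t in (M_i∖γ_i)∪C_i}`.
**`FK.levels_le_twoSum_nonpos_of_UU`: the levelwise inequality on the six cells and `0 ≤ 𝕌` imply the levelwise inequality on the glued cell
`(M₁ ∪ M₂, C₁ ∪ C₂)` at cut-off `J`, for arbitrary increasing `f` reading only `S` and `g` blind to `S`.**  This is the exact, `|S|`-uniform reduction of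
Conjecture `C_∞⁺` on series–parallel graphs to the sign of one explicit cross form (memo FROM-fk-2-g33-ODD-EVEN §3, FK-Q2 §42; census: some
2-separation with `𝕌 ≥ 0` exists in each of 76·10⁶ exact instances on all 2-connected SP hosts with ≤ 8 edges).  When `f` and `g` live on different sides,
`𝕌` is a sum of products of two Theorem-U functionals (`FK.apUpcCLW_nonneg_of_isTTSP` with a one-level weight) and the other terms vanish.
[cite: Grimmett2006, §1.4 eq. (1.20) (p. 15); §3.8 Thm. (3.90) (pp. 61–62); §3.9 (pp. 63–64)] [cite: Wagner2006, Thm. 5.8(d), §5.3]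
-/

noncomputable section

namespace Summit.CriticalPhenomena.PercolationContinuityZ3.Theorems

namespace FK

open SimpleGraph Literature.Probability.LatticeModels Literature.Probability.Percolation
open scoped Classical

variable {V : Type*} [Fintype V]

section TwoSum

variable {E₁ E₂ : Finset (Sym2 V)} {V₁ V₂ : Set V} {s t : V}

/-- **`C_∞⁺` ACROSS A 2-SEPARATION REDUCES TO THE DOUBLE-U FORM.**  Parallel gluing `E₁ ∥ E₂` at `s ≠ t` (vertex supports `V₁ ∩ V₂ ⊆ {s,t}`), cells
`M_i, C_i ⊆ E_i` (disjoint, `st ∉ M₁ ∪ M₂`).  Hypotheses `hA₀, hA₁, hA₂` / `hB₀, hB₁, hB₂`: the levelwise antipodal inequality on the cells `(M₁,C₁)`,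
`(M₁, C₁ ∪ {st})`, `(M₁ ∪ {st}, C₁)` / the same three on side 2 (each: for every `S'`, every increasing `f'` reading only `S'`, every increasing `g'` blind
to `S'`, every cut-off).  Hypothesis `hUU`: `0 ≤ 𝕌` (the double-U cross form at level `J + 2|V|`).  Conclusion: the levelwise inequality on
`(M₁ ∪ M₂, C₁ ∪ C₂)` at cut-off `J`.  [cite: Grimmett2006, §3.8 Thm. (3.90) (pp. 61–62); §3.9 (pp. 63–64)] [cite: Wagner2006, Thm. 5.8(d), §5.3] -/
theorem levels_le_twoSum_nonpos_of_UU (hd : Disjoint E₁ E₂) (hV₁ : ∀ e ∈ (↑E₁ : Set (Sym2 V)), ∀ z ∈ e, z ∈ V₁)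
    (hV₂ : ∀ e ∈ (↑E₂ : Set (Sym2 V)), ∀ z ∈ e, z ∈ V₂) (hS : V₁ ∩ V₂ ⊆ {s, t}) (hst : s ≠ t)
    {M₁ M₂ C₁ C₂ : Finset (Sym2 V)} (hM₁ : M₁ ⊆ E₁) (hM₂ : M₂ ⊆ E₂) (hC₁ : C₁ ⊆ E₁) (hC₂ : C₂ ⊆ E₂)
    (hMC₁ : Disjoint M₁ C₁) (hMC₂ : Disjoint M₂ C₂) (hst₁ : s(s, t) ∉ M₁) (hst₂ : s(s, t) ∉ M₂)
    (hA : ∀ M' C' : Finset (Sym2 V),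
      (M' = M₁ ∧ C' = C₁) ∨ (M' = M₁ ∧ C' = insert s(s, t) C₁) ∨ (M' = insert s(s, t) M₁ ∧ C' = C₁) →
      ∀ S' : Finset (Sym2 V), ∀ f' g' : Finset (Sym2 V) → ℝ,
      (∀ e : Sym2 V, e ∉ S' → ∀ A : Finset (Sym2 V), f' (insert e A) = f' A) →
      (∀ ⦃A B : Finset (Sym2 V)⦄, A ⊆ B → f' A ≤ f' B) →
      (∀ e ∈ S', ∀ A : Finset (Sym2 V), g' (insert e A) = g' A) →
      (∀ ⦃A B : Finset (Sym2 V)⦄, A ⊆ B → g' A ≤ g' B) → ∀ J' : ℕ,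
      ∑ γ ∈ M'.powerset with apExpC M' C' γ ≤ J',
        (f' (γ ∪ C') - f' (M' \ γ ∪ C')) * (g' (γ ∪ C') - g' (M' \ γ ∪ C')) ≤ 0)
    (hB : ∀ M' C' : Finset (Sym2 V),
      (M' = M₂ ∧ C' = C₂) ∨ (M' = M₂ ∧ C' = insert s(s, t) C₂) ∨ (M' = insert s(s, t) M₂ ∧ C' = C₂) →
      ∀ S' : Finset (Sym2 V), ∀ f' g' : Finset (Sym2 V) → ℝ,
      (∀ e : Sym2 V, e ∉ S' → ∀ A : Finset (Sym2 V), f' (insert e A) = f' A) →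
      (∀ ⦃A B : Finset (Sym2 V)⦄, A ⊆ B → f' A ≤ f' B) →
      (∀ e ∈ S', ∀ A : Finset (Sym2 V), g' (insert e A) = g' A) →
      (∀ ⦃A B : Finset (Sym2 V)⦄, A ⊆ B → g' A ≤ g' B) → ∀ J' : ℕ,
      ∑ γ ∈ M'.powerset with apExpC M' C' γ ≤ J',
        (f' (γ ∪ C') - f' (M' \ γ ∪ C')) * (g' (γ ∪ C') - g' (M' \ γ ∪ C')) ≤ 0)
    {S : Finset (Sym2 V)} {f g : Finset (Sym2 V) → ℝ}
    (hf : ∀ e : Sym2 V, e ∉ S → ∀ A : Finset (Sym2 V), f (insert e A) = f A)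
    (hfm : ∀ ⦃A B : Finset (Sym2 V)⦄, A ⊆ B → f A ≤ f B)
    (hg : ∀ e ∈ S, ∀ A : Finset (Sym2 V), g (insert e A) = g A)
    (hgm : ∀ ⦃A B : Finset (Sym2 V)⦄, A ⊆ B → g A ≤ g B) (J : ℕ)
    (hUU : 0 ≤ ∑ γ₁ ∈ M₁.powerset, ∑ γ₂ ∈ M₂.powerset,
      if apExpC M₁ C₁ γ₁ + apExpC M₂ C₂ γ₂ = J + 2 * Fintype.card V then
        ((if (openGraph (↑(γ₁ ∪ C₁) : BondConfig V)).Reachable s t then (1 : ℝ) else 0) -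
            (if (openGraph (↑(M₁ \ γ₁ ∪ C₁) : BondConfig V)).Reachable s t then (1 : ℝ) else 0)) *
          ((if (openGraph (↑(γ₂ ∪ C₂) : BondConfig V)).Reachable s t then (1 : ℝ) else 0) -
            (if (openGraph (↑(M₂ \ γ₂ ∪ C₂) : BondConfig V)).Reachable s t then (1 : ℝ) else 0)) *
          ((f (γ₁ ∪ γ₂ ∪ (C₁ ∪ C₂)) - f (M₁ \ γ₁ ∪ M₂ \ γ₂ ∪ (C₁ ∪ C₂))) *
            (g (γ₁ ∪ γ₂ ∪ (C₁ ∪ C₂)) - g (M₁ \ γ₁ ∪ M₂ \ γ₂ ∪ (C₁ ∪ C₂))))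
      else 0) :
    ∑ γ ∈ (M₁ ∪ M₂).powerset with apExpC (M₁ ∪ M₂) (C₁ ∪ C₂) γ ≤ J,
      (f (γ ∪ (C₁ ∪ C₂)) - f ((M₁ ∪ M₂) \ γ ∪ (C₁ ∪ C₂))) * (g (γ ∪ (C₁ ∪ C₂)) - g ((M₁ ∪ M₂) \ γ ∪ (C₁ ∪ C₂))) ≤ 0 := by
  have hdM : Disjoint M₁ M₂ := Finset.disjoint_of_subset_left hM₁ (Finset.disjoint_of_subset_right hM₂ hd)
  set C : Finset (Sym2 V) := C₁ ∪ C₂ with hCdef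
  set N : ℕ := Fintype.card V with hNdef
  -- connection indicators of the two sides
  set a₁ : Finset (Sym2 V) → Bool := fun γ₁ => decide ((openGraph (↑(γ₁ ∪ C₁) : BondConfig V)).Reachable s t) with ha₁
  set b₁ : Finset (Sym2 V) → Bool := fun γ₁ => decide ((openGraph (↑(M₁ \ γ₁ ∪ C₁) : BondConfig V)).Reachable s t) with hb₁
  set a₂ : Finset (Sym2 V) → Bool := fun γ₂ => decide ((openGraph (↑(γ₂ ∪ C₂) : BondConfig V)).Reachable s t) with ha₂
  set b₂ : Finset (Sym2 V) → Bool := fun γ₂ => decide ((openGraph (↑(M₂ \ γ₂ ∪ C₂) : BondConfig V)).Reachable s t) with hb₂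
  -- the two-sided antipodal differences and their odd / even parts (as in file 75a)
  set fh : Finset (Sym2 V) → Finset (Sym2 V) → ℝ := fun γ₁ γ₂ => f (γ₁ ∪ γ₂ ∪ C) - f (M₁ \ γ₁ ∪ M₂ \ γ₂ ∪ C) with hfh
  set gh : Finset (Sym2 V) → Finset (Sym2 V) → ℝ := fun γ₁ γ₂ => g (γ₁ ∪ γ₂ ∪ C) - g (M₁ \ γ₁ ∪ M₂ \ γ₂ ∪ C) with hgh
  set P : Finset (Sym2 V) → Finset (Sym2 V) → ℝ := fun γ₁ γ₂ => (fh γ₁ γ₂ + fh γ₁ (M₂ \ γ₂)) / 2 with hP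
  set Ef : Finset (Sym2 V) → Finset (Sym2 V) → ℝ := fun γ₁ γ₂ => (fh γ₁ γ₂ - fh γ₁ (M₂ \ γ₂)) / 2 with hEf
  set Q : Finset (Sym2 V) → Finset (Sym2 V) → ℝ := fun γ₁ γ₂ => (gh γ₁ γ₂ + gh γ₁ (M₂ \ γ₂)) / 2 with hQ
  set Dg : Finset (Sym2 V) → Finset (Sym2 V) → ℝ := fun γ₁ γ₂ => (gh γ₁ γ₂ - gh γ₁ (M₂ \ γ₂)) / 2 with hDg
  -- the typed level: `lv γ₁ γ₂ = ℓ₁ + ℓ₂ + [a₁ ∧ a₂] + [b₁ ∧ b₂]`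
  set lv : Finset (Sym2 V) → Finset (Sym2 V) → ℕ := fun γ₁ γ₂ =>
    apExpC M₁ C₁ γ₁ + apExpC M₂ C₂ γ₂ + (if a₁ γ₁ = true ∧ a₂ γ₂ = true then 1 else 0) +
      (if b₁ γ₁ = true ∧ b₂ γ₂ = true then 1 else 0) with hlv
  set ind : Finset (Sym2 V) → Finset (Sym2 V) → ℝ := fun γ₁ γ₂ => if lv γ₁ γ₂ ≤ J + 2 * N then 1 else 0 with hind
  set m : ℕ := J + 2 * N with hm
  /- Step 1: the glued sum as a typed double sum. -/
  have step1 : ∑ γ ∈ (M₁ ∪ M₂).powerset with apExpC (M₁ ∪ M₂) (C₁ ∪ C₂) γ ≤ J,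
      (f (γ ∪ (C₁ ∪ C₂)) - f ((M₁ ∪ M₂) \ γ ∪ (C₁ ∪ C₂))) * (g (γ ∪ (C₁ ∪ C₂)) - g ((M₁ ∪ M₂) \ γ ∪ (C₁ ∪ C₂))) =
      ∑ γ₁ ∈ M₁.powerset, ∑ γ₂ ∈ M₂.powerset, ind γ₁ γ₂ * (fh γ₁ γ₂ * gh γ₁ γ₂) := by
    rw [Finset.sum_filter, sum_powerset_union_disj hdM]
    refine Finset.sum_congr rfl fun γ₁ hγ₁ => Finset.sum_congr rfl fun γ₂ hγ₂ => ?_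
    have hγ₁' : γ₁ ⊆ M₁ := Finset.mem_powerset.1 hγ₁
    have hγ₂' : γ₂ ⊆ M₂ := Finset.mem_powerset.1 hγ₂
    have hlev := apExpC_parallel hd hV₁ hV₂ hS hst hM₁ hM₂ hC₁ hC₂ hγ₁' hγ₂'
    have hiff : apExpC (M₁ ∪ M₂) (C₁ ∪ C₂) (γ₁ ∪ γ₂) ≤ J ↔ lv γ₁ γ₂ ≤ J + 2 * N := by
      simp only [hlv, ha₁, ha₂, hb₁, hb₂, decide_eq_true_eq, hNdef]
      omega
    have hsd : (M₁ ∪ M₂) \ (γ₁ ∪ γ₂) ∪ (C₁ ∪ C₂) = M₁ \ γ₁ ∪ M₂ \ γ₂ ∪ C := by rw [union_sdiff_union hdM hγ₁' hγ₂']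
    simp only [hind, hfh, hgh]
    by_cases hle : apExpC (M₁ ∪ M₂) (C₁ ∪ C₂) (γ₁ ∪ γ₂) ≤ J
    · rw [if_pos hle, if_pos (hiff.1 hle), one_mul, hsd]
    · rw [if_neg hle, if_neg (fun h => hle (hiff.2 h)), zero_mul]
  rw [step1]
  /- Step 2: pointwise odd / even expansion. -/
  have step2 : ∀ γ₁ γ₂ : Finset (Sym2 V), ind γ₁ γ₂ * (fh γ₁ γ₂ * gh γ₁ γ₂) =
      ind γ₁ γ₂ * (P γ₁ γ₂ * Q γ₁ γ₂) + ind γ₁ γ₂ * (Ef γ₁ γ₂ * Dg γ₁ γ₂) +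
        ind γ₁ γ₂ * (P γ₁ γ₂ * Dg γ₁ γ₂ + Ef γ₁ γ₂ * Q γ₁ γ₂) := by
    intro γ₁ γ₂; simp only [hP, hEf, hQ, hDg]; ring
  simp_rw [step2, Finset.sum_add_distrib]
  /- Symmetries. -/
  have fh_flip₁ : ∀ γ₁ γ₂ : Finset (Sym2 V), γ₁ ⊆ M₁ → γ₂ ⊆ M₂ → fh (M₁ \ γ₁) γ₂ = -fh γ₁ (M₂ \ γ₂) := by
    intro γ₁ γ₂ hγ₁ hγ₂
    simp only [hfh, Finset.sdiff_sdiff_eq_self hγ₁, Finset.sdiff_sdiff_eq_self hγ₂]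
    ring
  have gh_flip₁ : ∀ γ₁ γ₂ : Finset (Sym2 V), γ₁ ⊆ M₁ → γ₂ ⊆ M₂ → gh (M₁ \ γ₁) γ₂ = -gh γ₁ (M₂ \ γ₂) := by
    intro γ₁ γ₂ hγ₁ hγ₂
    simp only [hgh, Finset.sdiff_sdiff_eq_self hγ₁, Finset.sdiff_sdiff_eq_self hγ₂]
    ring
  have Ef_flip₁ : ∀ γ₁ γ₂ : Finset (Sym2 V), γ₁ ⊆ M₁ → γ₂ ⊆ M₂ → Ef (M₁ \ γ₁) γ₂ = Ef γ₁ γ₂ := by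
    intro γ₁ γ₂ hγ₁ hγ₂
    simp only [hEf]
    rw [fh_flip₁ γ₁ γ₂ hγ₁ hγ₂, fh_flip₁ γ₁ (M₂ \ γ₂) hγ₁ Finset.sdiff_subset, Finset.sdiff_sdiff_eq_self hγ₂]
    ring
  have Dg_flip₁ : ∀ γ₁ γ₂ : Finset (Sym2 V), γ₁ ⊆ M₁ → γ₂ ⊆ M₂ → Dg (M₁ \ γ₁) γ₂ = Dg γ₁ γ₂ := by
    intro γ₁ γ₂ hγ₁ hγ₂
    simp only [hDg]
    rw [gh_flip₁ γ₁ γ₂ hγ₁ hγ₂, gh_flip₁ γ₁ (M₂ \ γ₂) hγ₁ Finset.sdiff_subset, Finset.sdiff_sdiff_eq_self hγ₂]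
    ring
  have P_flip₂ : ∀ γ₁ γ₂ : Finset (Sym2 V), γ₂ ⊆ M₂ → P γ₁ (M₂ \ γ₂) = P γ₁ γ₂ := by
    intro γ₁ γ₂ hγ₂; simp only [hP, Finset.sdiff_sdiff_eq_self hγ₂]; ring
  have Q_flip₂ : ∀ γ₁ γ₂ : Finset (Sym2 V), γ₂ ⊆ M₂ → Q γ₁ (M₂ \ γ₂) = Q γ₁ γ₂ := by
    intro γ₁ γ₂ hγ₂; simp only [hQ, Finset.sdiff_sdiff_eq_self hγ₂]; ring
  have a₁_flip : ∀ γ₁ : Finset (Sym2 V), γ₁ ⊆ M₁ → a₁ (M₁ \ γ₁) = b₁ γ₁ := by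
    intro γ₁ hγ₁; simp only [ha₁, hb₁]
  have b₁_flip : ∀ γ₁ : Finset (Sym2 V), γ₁ ⊆ M₁ → b₁ (M₁ \ γ₁) = a₁ γ₁ := by
    intro γ₁ hγ₁; simp only [ha₁, hb₁, Finset.sdiff_sdiff_eq_self hγ₁]
  have a₂_flip : ∀ γ₂ : Finset (Sym2 V), γ₂ ⊆ M₂ → a₂ (M₂ \ γ₂) = b₂ γ₂ := by
    intro γ₂ hγ₂; simp only [ha₂, hb₂]
  have b₂_flip : ∀ γ₂ : Finset (Sym2 V), γ₂ ⊆ M₂ → b₂ (M₂ \ γ₂) = a₂ γ₂ := by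
    intro γ₂ hγ₂; simp only [ha₂, hb₂, Finset.sdiff_sdiff_eq_self hγ₂]
  have ℓ₁_flip : ∀ γ₁ : Finset (Sym2 V), γ₁ ⊆ M₁ → apExpC M₁ C₁ (M₁ \ γ₁) = apExpC M₁ C₁ γ₁ :=
    fun γ₁ hγ₁ => apExpC_sdiff M₁ C₁ hγ₁
  have ℓ₂_flip : ∀ γ₂ : Finset (Sym2 V), γ₂ ⊆ M₂ → apExpC M₂ C₂ (M₂ \ γ₂) = apExpC M₂ C₂ γ₂ :=
    fun γ₂ hγ₂ => apExpC_sdiff M₂ C₂ hγ₂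
  /- Step A: the `PQ` terms. -/
  have stepA : ∑ γ₁ ∈ M₁.powerset, ∑ γ₂ ∈ M₂.powerset, ind γ₁ γ₂ * (P γ₁ γ₂ * Q γ₁ γ₂) ≤ 0 := by
    rw [Finset.sum_comm]
    -- symmetrise over `γ₂ ↦ M₂ \ γ₂`
    have hsym : ∑ γ₂ ∈ M₂.powerset, ∑ γ₁ ∈ M₁.powerset, ind γ₁ γ₂ * (P γ₁ γ₂ * Q γ₁ γ₂) =
        (∑ γ₂ ∈ M₂.powerset, ∑ γ₁ ∈ M₁.powerset, (ind γ₁ γ₂ + ind γ₁ (M₂ \ γ₂)) * (P γ₁ γ₂ * Q γ₁ γ₂)) / 2 := by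
      have h2 := sum_powerset_flip M₂ (fun γ₂ => ∑ γ₁ ∈ M₁.powerset, ind γ₁ γ₂ * (P γ₁ γ₂ * Q γ₁ γ₂))
      have h3 : ∑ γ₂ ∈ M₂.powerset, ∑ γ₁ ∈ M₁.powerset, ind γ₁ (M₂ \ γ₂) * (P γ₁ (M₂ \ γ₂) * Q γ₁ (M₂ \ γ₂)) =
          ∑ γ₂ ∈ M₂.powerset, ∑ γ₁ ∈ M₁.powerset, ind γ₁ (M₂ \ γ₂) * (P γ₁ γ₂ * Q γ₁ γ₂) := by
        refine Finset.sum_congr rfl fun γ₂ hγ₂ => Finset.sum_congr rfl fun γ₁ _ => ?_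
        rw [P_flip₂ γ₁ γ₂ (Finset.mem_powerset.1 hγ₂), Q_flip₂ γ₁ γ₂ (Finset.mem_powerset.1 hγ₂)]
      rw [h3] at h2
      have h4 : ∑ γ₂ ∈ M₂.powerset, ∑ γ₁ ∈ M₁.powerset, (ind γ₁ γ₂ + ind γ₁ (M₂ \ γ₂)) * (P γ₁ γ₂ * Q γ₁ γ₂) =
          (∑ γ₂ ∈ M₂.powerset, ∑ γ₁ ∈ M₁.powerset, ind γ₁ γ₂ * (P γ₁ γ₂ * Q γ₁ γ₂)) +
            ∑ γ₂ ∈ M₂.powerset, ∑ γ₁ ∈ M₁.powerset, ind γ₁ (M₂ \ γ₂) * (P γ₁ γ₂ * Q γ₁ γ₂) := by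
        rw [← Finset.sum_add_distrib]
        refine Finset.sum_congr rfl fun γ₂ _ => ?_
        rw [← Finset.sum_add_distrib]
        exact Finset.sum_congr rfl fun γ₁ _ => by ring
      rw [h4, ← h2]; ring
    rw [hsym]
    refine div_nonpos_of_nonpos_of_nonneg (Finset.sum_nonpos fun γ₂ hγ₂ => ?_) (by norm_num)
    have hγ₂' : γ₂ ⊆ M₂ := Finset.mem_powerset.1 hγ₂
    -- the averaged test functions on side 1
    set f₁ : Finset (Sym2 V) → ℝ := fun A => (f (A ∩ M₁ ∪ γ₂ ∪ C) + f (A ∩ M₁ ∪ (M₂ \ γ₂) ∪ C)) / 2 with hf₁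
    set g₁ : Finset (Sym2 V) → ℝ := fun A => (g (A ∩ M₁ ∪ γ₂ ∪ C) + g (A ∩ M₁ ∪ (M₂ \ γ₂) ∪ C)) / 2 with hg₁
    have hf₁r := avg_notRead hf M₁ γ₂ (M₂ \ γ₂) C
    have hf₁m : ∀ ⦃A B : Finset (Sym2 V)⦄, A ⊆ B → f₁ A ≤ f₁ B := fun A B hAB => avg_mono hfm M₁ γ₂ (M₂ \ γ₂) C hAB
    have hg₁b := avg_blind hg M₁ γ₂ (M₂ \ γ₂) C
    have hg₁m : ∀ ⦃A B : Finset (Sym2 V)⦄, A ⊆ B → g₁ A ≤ g₁ B := fun A B hAB => avg_mono hgm M₁ γ₂ (M₂ \ γ₂) C hAB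
    have hf₁M : ∀ A : Finset (Sym2 V), f₁ A = f₁ (A ∩ M₁) := by
      intro A; simp only [hf₁, Finset.inter_assoc, Finset.inter_self]
    have hg₁M : ∀ A : Finset (Sym2 V), g₁ A = g₁ (A ∩ M₁) := by
      intro A; simp only [hg₁, Finset.inter_assoc, Finset.inter_self]
    have hPQ : ∀ γ₁ : Finset (Sym2 V), γ₁ ⊆ M₁ →
        P γ₁ γ₂ * Q γ₁ γ₂ = (f₁ γ₁ - f₁ (M₁ \ γ₁)) * (g₁ γ₁ - g₁ (M₁ \ γ₁)) := by
      intro γ₁ hγ₁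
      simp only [hP, hQ, hfh, hgh, hf₁, hg₁, Finset.inter_eq_left.2 hγ₁, Finset.inter_eq_left.2 Finset.sdiff_subset,
        Finset.sdiff_sdiff_eq_self hγ₂']
      ring
    have hsum2 : ∑ γ₁ ∈ M₁.powerset, (ind γ₁ γ₂ + ind γ₁ (M₂ \ γ₂)) * (P γ₁ γ₂ * Q γ₁ γ₂) =
        ∑ γ₁ ∈ M₁.powerset,
          ((if apExpC M₁ C₁ γ₁ + apExpC M₂ C₂ γ₂ + (if a₁ γ₁ = true ∧ a₂ γ₂ = true then 1 else 0) +
                (if b₁ γ₁ = true ∧ b₂ γ₂ = true then 1 else 0) ≤ m then (1 : ℝ) else 0) +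
            (if apExpC M₁ C₁ γ₁ + apExpC M₂ C₂ γ₂ + (if a₁ γ₁ = true ∧ b₂ γ₂ = true then 1 else 0) +
                (if b₁ γ₁ = true ∧ a₂ γ₂ = true then 1 else 0) ≤ m then (1 : ℝ) else 0)) *
            ((f₁ γ₁ - f₁ (M₁ \ γ₁)) * (g₁ γ₁ - g₁ (M₁ \ γ₁))) := by
      refine Finset.sum_congr rfl fun γ₁ hγ₁ => ?_
      rw [hPQ γ₁ (Finset.mem_powerset.1 hγ₁)]
      simp only [hind, hlv, a₂_flip γ₂ hγ₂', b₂_flip γ₂ hγ₂', ℓ₂_flip γ₂ hγ₂']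
    rw [hsum2]
    exact twoSum_half₁_nonpos hMC₁ hst₁ hA hf₁r hf₁m hg₁b hg₁m hf₁M hg₁M a₁ b₁ ha₁ hb₁ (apExpC M₂ C₂ γ₂) m (a₂ γ₂) (b₂ γ₂)
  /- Step B: the `ED` terms (mirror image: symmetrise over `γ₁`, instances on the side-2 cells). -/
  have stepB : ∑ γ₁ ∈ M₁.powerset, ∑ γ₂ ∈ M₂.powerset, ind γ₁ γ₂ * (Ef γ₁ γ₂ * Dg γ₁ γ₂) ≤ 0 := by
    have hsym : ∑ γ₁ ∈ M₁.powerset, ∑ γ₂ ∈ M₂.powerset, ind γ₁ γ₂ * (Ef γ₁ γ₂ * Dg γ₁ γ₂) =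
        (∑ γ₁ ∈ M₁.powerset, ∑ γ₂ ∈ M₂.powerset, (ind γ₁ γ₂ + ind (M₁ \ γ₁) γ₂) * (Ef γ₁ γ₂ * Dg γ₁ γ₂)) / 2 := by
      have h2 := sum_powerset_flip M₁ (fun γ₁ => ∑ γ₂ ∈ M₂.powerset, ind γ₁ γ₂ * (Ef γ₁ γ₂ * Dg γ₁ γ₂))
      have h3 : ∑ γ₁ ∈ M₁.powerset, ∑ γ₂ ∈ M₂.powerset, ind (M₁ \ γ₁) γ₂ * (Ef (M₁ \ γ₁) γ₂ * Dg (M₁ \ γ₁) γ₂) =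
          ∑ γ₁ ∈ M₁.powerset, ∑ γ₂ ∈ M₂.powerset, ind (M₁ \ γ₁) γ₂ * (Ef γ₁ γ₂ * Dg γ₁ γ₂) := by
        refine Finset.sum_congr rfl fun γ₁ hγ₁ => Finset.sum_congr rfl fun γ₂ hγ₂ => ?_
        rw [Ef_flip₁ γ₁ γ₂ (Finset.mem_powerset.1 hγ₁) (Finset.mem_powerset.1 hγ₂),
          Dg_flip₁ γ₁ γ₂ (Finset.mem_powerset.1 hγ₁) (Finset.mem_powerset.1 hγ₂)]
      rw [h3] at h2
      have h4 : ∑ γ₁ ∈ M₁.powerset, ∑ γ₂ ∈ M₂.powerset, (ind γ₁ γ₂ + ind (M₁ \ γ₁) γ₂) * (Ef γ₁ γ₂ * Dg γ₁ γ₂) =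
          (∑ γ₁ ∈ M₁.powerset, ∑ γ₂ ∈ M₂.powerset, ind γ₁ γ₂ * (Ef γ₁ γ₂ * Dg γ₁ γ₂)) +
            ∑ γ₁ ∈ M₁.powerset, ∑ γ₂ ∈ M₂.powerset, ind (M₁ \ γ₁) γ₂ * (Ef γ₁ γ₂ * Dg γ₁ γ₂) := by
        rw [← Finset.sum_add_distrib]
        refine Finset.sum_congr rfl fun γ₁ _ => ?_
        rw [← Finset.sum_add_distrib]
        exact Finset.sum_congr rfl fun γ₂ _ => by ring
      rw [h4, ← h2]; ring
    rw [hsym]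
    refine div_nonpos_of_nonpos_of_nonneg (Finset.sum_nonpos fun γ₁ hγ₁ => ?_) (by norm_num)
    have hγ₁' : γ₁ ⊆ M₁ := Finset.mem_powerset.1 hγ₁
    -- the averaged test functions on side 2
    set f₂ : Finset (Sym2 V) → ℝ := fun A => (f (γ₁ ∪ A ∩ M₂ ∪ C) + f (M₁ \ γ₁ ∪ A ∩ M₂ ∪ C)) / 2 with hf₂
    set g₂ : Finset (Sym2 V) → ℝ := fun A => (g (γ₁ ∪ A ∩ M₂ ∪ C) + g (M₁ \ γ₁ ∪ A ∩ M₂ ∪ C)) / 2 with hg₂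
    have hf₂r := avg_notRead' hf M₂ γ₁ (M₁ \ γ₁) C
    have hf₂m : ∀ ⦃A B : Finset (Sym2 V)⦄, A ⊆ B → f₂ A ≤ f₂ B := fun A B hAB => avg_mono' hfm M₂ γ₁ (M₁ \ γ₁) C hAB
    have hg₂b := avg_blind' hg M₂ γ₁ (M₁ \ γ₁) C
    have hg₂m : ∀ ⦃A B : Finset (Sym2 V)⦄, A ⊆ B → g₂ A ≤ g₂ B := fun A B hAB => avg_mono' hgm M₂ γ₁ (M₁ \ γ₁) C hAB
    have hf₂M : ∀ A : Finset (Sym2 V), f₂ A = f₂ (A ∩ M₂) := by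
      intro A; simp only [hf₂, Finset.inter_assoc, Finset.inter_self]
    have hg₂M : ∀ A : Finset (Sym2 V), g₂ A = g₂ (A ∩ M₂) := by
      intro A; simp only [hg₂, Finset.inter_assoc, Finset.inter_self]
    have hED : ∀ γ₂ : Finset (Sym2 V), γ₂ ⊆ M₂ →
        Ef γ₁ γ₂ * Dg γ₁ γ₂ = (f₂ γ₂ - f₂ (M₂ \ γ₂)) * (g₂ γ₂ - g₂ (M₂ \ γ₂)) := by
      intro γ₂ hγ₂
      simp only [hEf, hDg, hfh, hgh, hf₂, hg₂, Finset.inter_eq_left.2 hγ₂, Finset.inter_eq_left.2 Finset.sdiff_subset,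
        Finset.sdiff_sdiff_eq_self hγ₂]
      ring
    have hsum2 : ∑ γ₂ ∈ M₂.powerset, (ind γ₁ γ₂ + ind (M₁ \ γ₁) γ₂) * (Ef γ₁ γ₂ * Dg γ₁ γ₂) =
        ∑ γ₂ ∈ M₂.powerset,
          ((if apExpC M₁ C₁ γ₁ + apExpC M₂ C₂ γ₂ + (if a₁ γ₁ = true ∧ a₂ γ₂ = true then 1 else 0) +
                (if b₁ γ₁ = true ∧ b₂ γ₂ = true then 1 else 0) ≤ m then (1 : ℝ) else 0) +
            (if apExpC M₁ C₁ γ₁ + apExpC M₂ C₂ γ₂ + (if b₁ γ₁ = true ∧ a₂ γ₂ = true then 1 else 0) +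
                (if a₁ γ₁ = true ∧ b₂ γ₂ = true then 1 else 0) ≤ m then (1 : ℝ) else 0)) *
            ((f₂ γ₂ - f₂ (M₂ \ γ₂)) * (g₂ γ₂ - g₂ (M₂ \ γ₂))) := by
      refine Finset.sum_congr rfl fun γ₂ hγ₂ => ?_
      rw [hED γ₂ (Finset.mem_powerset.1 hγ₂)]
      simp only [hind, hlv, a₁_flip γ₁ hγ₁', b₁_flip γ₁ hγ₁', ℓ₁_flip γ₁ hγ₁']
    rw [hsum2]
    exact twoSum_half₂_nonpos hMC₂ hst₂ hB hf₂r hf₂m hg₂b hg₂m hf₂M hg₂M a₂ b₂ ha₂ hb₂ (apExpC M₁ C₁ γ₁) m (a₁ γ₁) (b₁ γ₁)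
  /- Step C: the cross terms are `-𝕌/2`. -/
  have stepC : ∑ γ₁ ∈ M₁.powerset, ∑ γ₂ ∈ M₂.powerset, ind γ₁ γ₂ * (P γ₁ γ₂ * Dg γ₁ γ₂ + Ef γ₁ γ₂ * Q γ₁ γ₂) ≤ 0 := by
    have hUU' : 0 ≤ ∑ γ₁ ∈ M₁.powerset, ∑ γ₂ ∈ M₂.powerset,
        if apExpC M₁ C₁ γ₁ + apExpC M₂ C₂ γ₂ = m then
          ((if a₁ γ₁ = true then (1 : ℝ) else 0) - (if b₁ γ₁ = true then 1 else 0)) *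
            ((if a₂ γ₂ = true then (1 : ℝ) else 0) - (if b₂ γ₂ = true then 1 else 0)) * (fh γ₁ γ₂ * gh γ₁ γ₂)
        else 0 := by
      refine le_of_le_of_eq hUU (Finset.sum_congr rfl fun γ₁ _ => Finset.sum_congr rfl fun γ₂ _ => ?_)
      simp only [ha₁, hb₁, ha₂, hb₂, hfh, hgh, hm, hNdef, hCdef, decide_eq_true_eq]
    have key := twoSum_cross_le M₁ M₂ (apExpC M₁ C₁) (apExpC M₂ C₂) a₁ b₁ a₂ b₂ fh gh m ℓ₁_flip ℓ₂_flip a₁_flip b₁_flip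
      a₂_flip b₂_flip fh_flip₁ gh_flip₁ hUU'
    refine le_of_eq_of_le (Finset.sum_congr rfl fun γ₁ _ => Finset.sum_congr rfl fun γ₂ _ => ?_) key
    simp only [hind, hlv, hP, hEf, hQ, hDg]
  linarith [stepA, stepB, stepC]

end TwoSum

end FK

end Summit.CriticalPhenomena.PercolationContinuityZ3.Theorems

end
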